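import Summits.Ventures.HSemireg.WedgeHankelBoxSiegelIdeal

/-!
# Venture HSemireg — THE BOX SIEGEL IDEAL (2/2): `dim boxSiegelIdeal_k + [t^k] Π_i G_{m_i}(t) = C(Σ_i 2m_i, k)` with `G_m(t) = Σ_b (b+1)·C(m,b)·t^b`,
# a complement spanned by products of the factors' standard monomials, and THE EXCESS LAW FOR HANKEL BOXES in every degree

HONEST FRAMING. Part of the Lean index of the computation cell `pub-hsemireg` (seat p10 gen 12, Sunday typer «UNIFORM-IN-n»).
Finite-dimensional EXTERIOR ALGEBRA over a field + ranks of Hankel matrices + binomial arithmetic ONLY: no variety, no cohomology theory, no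
sheaf, no Ext group, no semiregularity map; nothing here says that HC / HC_CM / HC_AV holds; no Literature fact is declared or used.  Custodian
versions as in (1/2): FORMULA-N PART A §2.3 THEOREM K, §2.6 THEOREM H / FN-4 (i); STRUCTURE.md v1.0-SIGNED 9b196a05977dd067 §1.1 C15 / Σ2.  The
dictionary (`⌟(v₀ ⊠ ⋯ ⊠ v_{n−1})` on `HT^k(X₀ × ⋯ × X_{n−1})` ↦ `θ ↦ θ ∧ (v₀ ∧ ⋯ ∧ v_{n−1})`) is QUOTED, never asserted.

THIS FILE (continues namespace `Summit.Ventures.HSemireg.Wedge.HankelBoxSiegelIdeal`; imports (1/2)).  METHOD: no symmetrisation, no normal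
form — an induction on the number `j` of factors carrying three CRUDE estimates, which the dimension count then forces to be equalities:
* §5 the BOX-STANDARD SPAN `boxStd j k := Σ_{a+b=k} boxStd (j−1) a ∧ R_{j−1}^b` (products of the factors' standard parts; `boxStd 0 k = Hom(∅, k)`)
  and the COUNT `cnt j k := [t^k] Π_{i<j} G_{m_i}(t)`, `G_m(t) = Σ_b (b+1)·C(m,b)·t^b` (`stdPoly`; `cnt_succ` = the Cauchy product).
* §6 **THE INDUCTION `boxSI_census`** (for `j ≤ n`, every `k`): (i) `dim boxSI_j^k + cnt j k ≤ C(|pre j|, k)`, (ii) `Hom(pre j, k) ≤ boxStd_j^k +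
  boxSI_j^k`, (iii) `dim boxStd_j^k ≤ cnt j k`, (iv) `boxStd_j^k ≤ Hom(pre j, k)`.  Step: (ii) by the Künneth splitting `Hom(pre (j+1), k) ≤ Σ Hom(pre j, a)
  ∧ Hom(block j, b)`, `Hom(block j, b) = R_j^b + S_j^b` and the product inclusions of (1/2); (iii) by `dim(M ∧ N) ≤ dim M · dim N`; (i) by
  **`boxSI_succ_le`: `boxSI_{j+1}^k ≤ Σ_{a+b=k} (boxSI_j^a ∧ R_j^b + boxStd_j^a ∧ S_j^b + boxSI_j^a ∧ S_j^b)`** (a generator `E_t ∧ emb_i(s)` splits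
  `t` into its first-`j`-blocks part and its block-`j` part) and the arithmetic `Σ_{a+b=k} [(C(P,a) − c_a)·r_b + c_a·s_b + (C(P,a) − c_a)·s_b] =
  C(P + 2m_j, k) − Σ c_a r_b` (Vandermonde), done subtraction-free.
* §7 **THE THEOREMS** (every field, every `j ≤ n`, every `k`): **`finrank_boxSI_add_cnt`: `dim boxSI_j^k + cnt j k = C(|pre j|, k)`**;
  **`finrank_boxStd`: `dim boxStd_j^k = cnt j k`** (so the products of the factors' standard monomials are independent — a corollary, not an
  input); **`boxStd_sup_boxSI` / `boxStd_inf_boxSI`: `Hom(pre j, k) = boxStd_j^k ⊕ boxSI_j^k`**.  All factors: **`finrank_boxSiegelIdeal`: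
  `dim boxSiegelIdeal_k + [t^k] Π_i G_{m_i}(t) = C(Σ_i 2m_i, k)`**, `boxStd_sup_boxSiegelIdeal` / `boxStd_inf_boxSiegelIdeal` (a complement in `⋀^k`).
  Checks: one factor gives back `dim SI_k = C(2m,k) − (k+1)·C(m,k)`; two curve factors in degree 2: `C(4,2) − [t²](1+2t)² = 6 − 4 = 2 = dim SiegelBox`.
* §8 **THE EXCESS LAW FOR HANKEL BOXES** (with gen 10's HANKEL BOX LAW `rank(θ ↦ θ ∧ F ∣ ⋀^k) = [t^k] Π_i H_{m_i}(q_i)`):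
  **`finrank_ker_wedge_hankelBox_add`: `dim ker(θ ↦ θ ∧ F ∣ ⋀^k) + [t^k] Π_i H_{m_i}(q_i) = dim boxSiegelIdeal_k + [t^k] Π_i G_{m_i}`** — the
  `q`-dependent excess of the kernel over the box Siegel ideal is `[t^k](Π_i G_{m_i} − Π_i H_{m_i}(q_i))` — and **THE FULL-RANK CRITERION
  `ker_wedge_hankelBox_eq_iff`: `ker(θ ↦ θ ∧ F ∣ ⋀^k) = boxSiegelIdeal_k ⟺ [t^k] Π_i H_{m_i}(q_i) = [t^k] Π_i G_{m_i}`** (one factor: gen 11's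
  `ker_wedge_w_eq_siegelIdeal_iff`, `rank H_k(q) = k+1`).
NOT typed (honest): the common kernel `⋂_q ker(θ ↦ θ ∧ F_q ∣ ⋀^k) = boxSiegelIdeal_k` (⊇ is (1/2); ⊆ needs a factorwise stabilisation `m_i ↦ m_i + 2k`
as in gen 11's `WedgeHankelSiegelIdealStable` plus a Künneth statement for common kernels); which box classes attain the criterion beyond the middle
degrees (none can when `2k > min m_i`, as for one factor); anything Ext-side.  Class side only.
-/

open Module Polynomial

namespace Summit.Ventures.HSemireg.Wedge.HankelBoxSiegelIdeal

open Summit.Ventures.HSemireg.Wedge Summit.Ventures.HSemireg.Wedge.Kunneth Summit.Ventures.HSemireg.Wedge.MixedBox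
  Summit.Ventures.HSemireg.Wedge.HankelSiegel Summit.Ventures.HSemireg.Wedge.HankelSiegelIdeal
  Summit.Ventures.HSemireg.Wedge.HankelBox

variable (K : Type*) [Field K] {n : ℕ} (m : Fin n → ℕ)

/-! ## §5. The box-standard span and the count polynomial -/

/-- **THE BOX-STANDARD SPAN** of the first `j` factors in degree `k`: spanned by the products of standard monomials of the factors `i < j`
(recursively: `boxStd (j+1) k = Σ_{a ≤ k} boxStd j a ∧ R_j^{k−a}`, `boxStd 0 k = Hom(∅, k)` = the constants in degree `0`). -/
noncomputable def boxStd : ℕ → ℕ → Submodule K (HT K (Gen m))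
  | 0, k => Hom K (Gen m) ∅ k
  | j + 1, k => if hj : j < n then ⨆ a ∈ Finset.range (k + 1), boxStd j a * R K m ⟨j, hj⟩ (k - a) else boxStd j k

/-- no factors: the constants. -/
lemma boxStd_zero (k : ℕ) : boxStd K m 0 k = Hom K (Gen m) ∅ k := by
  rw [boxStd]

/-- one more factor: `boxStd (j+1) k = Σ_{a ≤ k} boxStd j a ∧ R_j^{k−a}`. -/
lemma boxStd_succ {j : ℕ} (hj : j < n) (k : ℕ) :
    boxStd K m (j + 1) k = ⨆ a ∈ Finset.range (k + 1), boxStd K m j a * R K m ⟨j, hj⟩ (k - a) := by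
  rw [boxStd, dif_pos hj]

/-- the one-factor COUNT POLYNOMIAL `G_m(t) := Σ_{b ≤ m} (b+1)·C(m,b)·t^b` (number of standard monomials `x_{S∖A} y_A` by degree = `dim ⋀^b / SI_b`). -/
noncomputable def stdPoly (M : ℕ) : Polynomial ℕ :=
  ∑ b ∈ Finset.range (M + 1), monomial b ((b + 1) * M.choose b)

/-- `[t^b] G_m = (b+1)·C(m,b)` for every `b` (both sides `0` beyond `m`). -/
lemma coeff_stdPoly (M b : ℕ) : (stdPoly M).coeff b = (b + 1) * M.choose b := by
  rw [stdPoly, finsetSum_coeff]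
  simp_rw [coeff_monomial]
  rw [Finset.sum_ite_eq']
  split_ifs with h
  · rfl
  · rw [Finset.mem_range, not_lt] at h
    rw [Nat.choose_eq_zero_of_lt (by omega), mul_zero]

/-- **THE BOX COUNT** `cnt j k := [t^k] Π_{i<j} G_{m_i}(t)` (number of box-standard monomials of the first `j` factors in degree `k`). -/
noncomputable def cnt (j k : ℕ) : ℕ := (∏ i ∈ Finset.range j, if h : i < n then stdPoly (m ⟨i, h⟩) else 1).coeff k

/-- no factors: `cnt 0 k = [k = 0]`. -/
lemma cnt_zero (k : ℕ) : cnt m 0 k = if k = 0 then 1 else 0 := by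
  rw [cnt, Finset.prod_range_zero, coeff_one]

/-- one more factor (Cauchy product): `cnt (j+1) k = Σ_{a ≤ k} cnt j a · (k−a+1)·C(m_j, k−a)`. -/
lemma cnt_succ {j : ℕ} (hj : j < n) (k : ℕ) :
    cnt m (j + 1) k = ∑ a ∈ Finset.range (k + 1), cnt m j a * ((k - a + 1) * (m ⟨j, hj⟩).choose (k - a)) := by
  rw [cnt, Finset.prod_range_succ, dif_pos hj, coeff_mul,
    Finset.Nat.sum_antidiagonal_eq_sum_range_succ
      (fun a b => (∏ i ∈ Finset.range j, if h : i < n then stdPoly (m ⟨i, h⟩) else 1).coeff a * (stdPoly (m ⟨j, hj⟩)).coeff b) k]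
  refine Finset.sum_congr rfl fun a _ => ?_
  rw [coeff_stdPoly, cnt]

/-- all factors: `cnt n k = [t^k] Π_{i : Fin n} G_{m_i}(t)`. -/
lemma cnt_top (k : ℕ) : cnt m n k = (∏ i : Fin n, stdPoly (m i)).coeff k := by
  rw [cnt, ← Fin.prod_univ_eq_prod_range (fun i => if h : i < n then stdPoly (m ⟨i, h⟩) else 1)]
  congr 1
  refine Finset.prod_congr rfl fun i _ => ?_
  rw [dif_pos i.2]

/-- Vandermonde, range form: `C(P + Q, k) = Σ_{a ≤ k} C(P, a)·C(Q, k − a)`. -/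
lemma add_choose_eq_sum_range (P Q k : ℕ) :
    (P + Q).choose k = ∑ a ∈ Finset.range (k + 1), P.choose a * Q.choose (k - a) := by
  rw [Nat.add_choose_eq, Finset.Nat.sum_antidiagonal_eq_sum_range_succ (fun a b => P.choose a * Q.choose b) k]

/-! ## §6. The induction on the number of factors -/

/-- the box-standard span is homogeneous on the prefix blocks. -/
lemma boxStd_le_Hom : ∀ {j : ℕ}, j ≤ n → ∀ k, boxStd K m j k ≤ Hom K (Gen m) (pre m j) k := by
  intro j
  induction j with
  | zero => intro _ k; rw [boxStd_zero, pre_zero]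
  | succ j ih =>
    intro hj k
    have hj' : j < n := by omega
    rw [boxStd_succ K m hj', pre_succ]
    refine iSup₂_le fun a ha => ?_
    have hak : a + (k - a) = k := by have := Finset.mem_range.mp ha; omega
    calc boxStd K m j a * R K m ⟨j, hj'⟩ (k - a)
        ≤ Hom K (Gen m) (pre m j) a * Hom K (Gen m) (blk m j) (k - a) := mul_le_mul' (ih (by omega) a) (R_le_Hom K m ⟨j, hj'⟩ (k - a))
      _ ≤ Hom K (Gen m) (pre m j ∪ blk m j) (a + (k - a)) := Hom_mul_Hom_le K (disjoint_pre_blk m hj') a (k - a)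
      _ = Hom K (Gen m) (pre m j ∪ blk m j) k := by rw [hak]

/-- **ONE MORE FACTOR, THE IDEAL SIDE: `boxSI_{j+1}^k ≤ Σ_{a ≤ k} (boxSI_j^a ∧ R_j^{k−a} + boxStd_j^a ∧ S_j^{k−a} + boxSI_j^a ∧ S_j^{k−a})`**, GIVEN the
decomposition `Hom(pre j, a) ≤ boxStd_j^a + boxSI_j^a` of the previous step: a generator `E_t ∧ emb_i(s)` (`t ⊆ pre (j+1)`) is `± E_{t₁} ∧ E_{t₂} ∧ emb_i(s)`
with `t₁ ⊆ pre j`, `t₂ ⊆ block j`; if `i < j` it is `± (E_{t₁} ∧ emb_i(s)) ∧ E_{t₂} ∈ boxSI_j ∧ (R_j + S_j)`; if `i = j` it is `E_{t₁} ∧ (E_{t₂} ∧ emb_j(s))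
∈ (boxStd_j + boxSI_j) ∧ S_j`. -/
theorem boxSI_succ_le {j : ℕ} (hj : j < n) (hdec : ∀ a, Hom K (Gen m) (pre m j) a ≤ boxStd K m j a ⊔ boxSI K m j a) (k : ℕ) :
    boxSI K m (j + 1) k ≤ ⨆ a ∈ Finset.range (k + 1),
      (boxSI K m j a * R K m ⟨j, hj⟩ (k - a) ⊔ boxStd K m j a * S K m ⟨j, hj⟩ (k - a) ⊔ boxSI K m j a * S K m ⟨j, hj⟩ (k - a)) := by
  classical
  rw [boxSI, Submodule.span_le]
  rintro _ ⟨⟨t, x⟩, ⟨ht, hk, hx⟩, rfl⟩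
  simp only at ht hk hx
  -- split the support into its prefix part `t₁` and its block-`j` part `t₂`
  have hdisj : Disjoint (t ∩ pre m j) (t \ pre m j) := by
    rw [Finset.disjoint_left]
    intro y hy hy'
    exact (Finset.mem_sdiff.mp hy').2 (Finset.mem_inter.mp hy).2
  have htu : t ∩ pre m j ∪ t \ pre m j = t := by rw [Finset.union_comm, Finset.sdiff_union_inter]
  have h₁ : t ∩ pre m j ⊆ pre m j := Finset.inter_subset_right
  have h₂ : t \ pre m j ⊆ blk m j := by
    intro y hy
    rw [Finset.mem_sdiff] at hy
    have hy' := ht hy.1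
    rw [pre_succ, Finset.mem_union] at hy'
    exact hy'.resolve_left hy.2
  have hle : (t ∩ pre m j).card ≤ t.card := Finset.card_le_card Finset.inter_subset_left
  have hcard : (t ∩ pre m j).card + (t \ pre m j).card = t.card := by
    have h := Finset.card_union_of_disjoint hdisj
    rw [htu] at h
    omega
  -- (`B_mul_B` spells the union through the linear order; `htu` is matched up to unfolding, not syntactically)
  have hB₀ : B K (Gen m) (t ∩ pre m j) * B K (Gen m) (t \ pre m j) = u K (t ∩ pre m j) (t \ pre m j) • B K (Gen m) t := by
    rw [B_mul_B]
    exact congrArg _ (congrArg _ htu)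
  have hB : B K (Gen m) t = (u K (t ∩ pre m j) (t \ pre m j))⁻¹ • (B K (Gen m) (t ∩ pre m j) * B K (Gen m) (t \ pre m j)) := by
    rw [hB₀, smul_smul, inv_mul_cancel₀ ((u_ne_zero_iff K).mpr hdisj), one_smul]
  show B K (Gen m) t * bsgen K m x ∈ _
  rw [hB, smul_mul_assoc]
  refine Submodule.smul_mem _ _ ?_
  obtain ⟨i, p⟩ := x
  simp only at hx
  rcases Nat.lt_succ_iff_lt_or_eq.mp hx with hij | hij
  · -- `i < j`: `(E_{t₁} ∧ emb_i(s)) ∧ E_{t₂}` with `E_{t₂} ∈ Hom(block j) = R_j ⊔ S_j`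
    have ha : (t ∩ pre m j).card + 2 < k + 1 := by omega
    have hgen : B K (Gen m) (t ∩ pre m j) * bsgen K m ⟨i, p⟩ ∈ boxSI K m j ((t ∩ pre m j).card + 2) :=
      B_mul_bsgen_mem_boxSI K m h₁ rfl hij
    have hmon : B K (Gen m) (t \ pre m j) ∈ R K m ⟨j, hj⟩ (k - ((t ∩ pre m j).card + 2)) ⊔ S K m ⟨j, hj⟩ (k - ((t ∩ pre m j).card + 2)) := by
      rw [R_sup_S]
      exact B_mem_Hom K h₂ (by omega)
    rw [mul_assoc, B_mul_bsgen_comm, ← mul_assoc]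
    refine Submodule.mem_iSup_of_mem ((t ∩ pre m j).card + 2) (Submodule.mem_iSup_of_mem (Finset.mem_range.mpr ha) ?_)
    have hmem := Submodule.mul_mem_mul hgen hmon
    rw [Submodule.mul_sup] at hmem
    rw [sup_assoc, sup_comm (boxStd K m j _ * _), ← sup_assoc]
    exact Submodule.mem_sup_left hmem
  · -- `i = j`: `E_{t₁} ∧ (E_{t₂} ∧ emb_j(s))` with `E_{t₁} ∈ Hom(pre j) ≤ boxStd_j ⊔ boxSI_j` and the second factor in `S_j`
    have hi : i = ⟨j, hj⟩ := Fin.ext hij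
    subst hi
    have ha : (t ∩ pre m j).card < k + 1 := by omega
    have hmon : B K (Gen m) (t ∩ pre m j) ∈ boxStd K m j (t ∩ pre m j).card ⊔ boxSI K m j (t ∩ pre m j).card :=
      hdec _ (B_mem_Hom K h₁ rfl)
    have hS : B K (Gen m) (t \ pre m j) * bsgen K m ⟨⟨j, hj⟩, p⟩ ∈ S K m ⟨j, hj⟩ (k - (t ∩ pre m j).card) := by
      have h := B_mul_bsgen_mem_S K m hj h₂ p
      rwa [show (t \ pre m j).card + 2 = k - (t ∩ pre m j).card by omega] at h
    rw [mul_assoc]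
    refine Submodule.mem_iSup_of_mem (t ∩ pre m j).card (Submodule.mem_iSup_of_mem (Finset.mem_range.mpr ha) ?_)
    have hmem := Submodule.mul_mem_mul hmon hS
    rw [Submodule.sup_mul] at hmem
    rw [sup_assoc]
    exact Submodule.mem_sup_right hmem

/-- **THE CENSUS INDUCTION** (`j ≤ n`, every `k`): (i) `dim boxSI_j^k + cnt j k ≤ C(|pre j|, k)`; (ii) `Hom(pre j, k) ≤ boxStd_j^k ⊔ boxSI_j^k`;
(iii) `dim boxStd_j^k ≤ cnt j k`.  (With `boxStd`, `boxSI ≤ Hom(pre j, k)` and `dim Hom(pre j, k) = C(|pre j|, k)` every inequality is forced to be an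
equality — §7.) -/
theorem boxSI_census : ∀ {j : ℕ}, j ≤ n → ∀ k,
    finrank K (boxSI K m j k) + cnt m j k ≤ (pre m j).card.choose k ∧
      Hom K (Gen m) (pre m j) k ≤ boxStd K m j k ⊔ boxSI K m j k ∧
      finrank K (boxStd K m j k) ≤ cnt m j k := by
  intro j
  induction j with
  | zero =>
    intro _ k
    rw [boxSI_zero, boxStd_zero, pre_zero, finrank_bot, cnt_zero, zero_add, finrank_Hom, Finset.card_empty]
    refine ⟨?_, le_sup_left, le_of_eq ?_⟩
    · cases k <;> simp
    · cases k <;> simp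
  | succ j ih =>
    intro hj k
    have hj' : j < n := by omega
    have ih' := ih (by omega)
    -- names for the numbers
    set P := (pre m j).card with hP
    set f : ℕ → ℕ := fun a => finrank K (boxSI K m j a) with hf
    set c : ℕ → ℕ := fun a => cnt m j a with hc
    set r : ℕ → ℕ := fun b => (b + 1) * (m ⟨j, hj'⟩).choose b with hr
    set s : ℕ → ℕ := fun b => finrank K (S K m ⟨j, hj'⟩ b) with hs
    have hrs : ∀ b, s b + r b = (m ⟨j, hj'⟩ + m ⟨j, hj'⟩).choose b := fun b => finrank_S K m ⟨j, hj'⟩ b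
    have hfc : ∀ a, f a + c a ≤ P.choose a := fun a => (ih' a).1
    have hdc : ∀ a, finrank K (boxStd K m j a) ≤ c a := fun a => (ih' a).2.2
    have hdec : ∀ a, Hom K (Gen m) (pre m j) a ≤ boxStd K m j a ⊔ boxSI K m j a := fun a => (ih' a).2.1
    refine ⟨?_, ?_, ?_⟩
    · -- (i): the ideal side
      have h1 : finrank K (boxSI K m (j + 1) k) ≤
          ∑ a ∈ Finset.range (k + 1), (f a * r (k - a) + c a * s (k - a) + f a * s (k - a)) := by
        refine (Submodule.finrank_mono (boxSI_succ_le K m hj' hdec k)).trans ((finrank_biSup_le_sum K _ _).trans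
          (Finset.sum_le_sum fun a _ => ?_))
        refine (Submodule.finrank_add_le_finrank_add_finrank _ _).trans (Nat.add_le_add
          ((Submodule.finrank_add_le_finrank_add_finrank _ _).trans (Nat.add_le_add ?_ ?_)) ?_)
        · exact (finrank_mul_le K _ _).trans (by rw [finrank_R])
        · exact (finrank_mul_le K _ _).trans (Nat.mul_le_mul_right _ (hdc a))
        · exact finrank_mul_le K _ _
      have h2 : cnt m (j + 1) k = ∑ a ∈ Finset.range (k + 1), c a * r (k - a) := cnt_succ m hj' k
      have h3 : (pre m (j + 1)).card.choose k = ∑ a ∈ Finset.range (k + 1), P.choose a * (m ⟨j, hj'⟩ + m ⟨j, hj'⟩).choose (k - a) := by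
        rw [card_pre_succ m hj', add_choose_eq_sum_range]
      rw [h2, h3]
      refine (Nat.add_le_add_right h1 _).trans ?_
      rw [← Finset.sum_add_distrib]
      refine Finset.sum_le_sum fun a _ => ?_
      rw [← hrs (k - a)]
      have := hfc a
      nlinarith [hfc a, Nat.zero_le (f a), Nat.zero_le (c a), Nat.zero_le (r (k - a)), Nat.zero_le (s (k - a))]
    · -- (ii): the decomposition of `Hom(pre (j+1), k)`
      rw [pre_succ]
      refine (Hom_union_le K (pre m j) (blk m j) k).trans (iSup₂_le fun a ha => ?_)
      have hak : a + (k - a) = k := by have := Finset.mem_range.mp ha; omega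
      calc Hom K (Gen m) (pre m j) a * Hom K (Gen m) (blk m j) (k - a)
          ≤ (boxStd K m j a ⊔ boxSI K m j a) * (R K m ⟨j, hj'⟩ (k - a) ⊔ S K m ⟨j, hj'⟩ (k - a)) :=
            mul_le_mul' (hdec a) (by rw [R_sup_S])
        _ = boxStd K m j a * R K m ⟨j, hj'⟩ (k - a) ⊔ boxStd K m j a * S K m ⟨j, hj'⟩ (k - a) ⊔
              (boxSI K m j a * R K m ⟨j, hj'⟩ (k - a) ⊔ boxSI K m j a * S K m ⟨j, hj'⟩ (k - a)) := by
            rw [Submodule.sup_mul, Submodule.mul_sup, Submodule.mul_sup]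
        _ ≤ boxStd K m (j + 1) k ⊔ boxSI K m (j + 1) k := by
            refine sup_le (sup_le ?_ ?_) (sup_le ?_ ?_)
            · rw [boxStd_succ K m hj']
              exact le_sup_of_le_left (le_iSup₂_of_le a ha le_rfl)
            · refine le_sup_of_le_right ((mul_le_mul' (boxStd_le_Hom K m (by omega) a) le_rfl).trans ?_)
              exact (Hom_mul_S_le K m hj' a (k - a)).trans (by rw [hak])
            · refine le_sup_of_le_right ((mul_le_mul' le_rfl (R_le_Hom K m ⟨j, hj'⟩ (k - a))).trans ?_)
              exact (boxSI_mul_Hom_le K m hj' a (k - a)).trans (by rw [hak])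
            · refine le_sup_of_le_right ((mul_le_mul' le_rfl (S_le_Hom K m ⟨j, hj'⟩ (k - a))).trans ?_)
              exact (boxSI_mul_Hom_le K m hj' a (k - a)).trans (by rw [hak])
    · -- (iii): the standard side
      rw [boxStd_succ K m hj', cnt_succ m hj']
      refine (finrank_biSup_le_sum K _ _).trans (Finset.sum_le_sum fun a _ => ?_)
      refine (finrank_mul_le K _ _).trans ?_
      rw [finrank_R]
      exact Nat.mul_le_mul_right _ (hdc a)

/-! ## §7. The theorems -/

section Prefix

variable {j : ℕ} (hj : j ≤ n) (k : ℕ)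
include hj

/-- **THE DIMENSION OF THE BOX SIEGEL IDEAL (first `j` factors): `dim boxSI_j^k + [t^k] Π_{i<j} G_{m_i}(t) = C(|pre j|, k)`.** -/
theorem finrank_boxSI_add_cnt : finrank K (boxSI K m j k) + cnt m j k = (pre m j).card.choose k := by
  obtain ⟨h1, h2, h3⟩ := boxSI_census K m hj k
  have h4 := (Submodule.finrank_mono h2).trans (Submodule.finrank_add_le_finrank_add_finrank _ _)
  rw [finrank_Hom] at h4
  omega

/-- **THE BOX-STANDARD SPAN HAS THE FULL COUNT: `dim boxStd_j^k = [t^k] Π_{i<j} G_{m_i}(t)`** — so the products of the factors' standard monomials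
(`(k_i+1)·C(m_i,k_i)` per factor and degree) are linearly independent: a COROLLARY of the count, not an input. -/
theorem finrank_boxStd : finrank K (boxStd K m j k) = cnt m j k := by
  obtain ⟨h1, h2, h3⟩ := boxSI_census K m hj k
  have h4 := (Submodule.finrank_mono h2).trans (Submodule.finrank_add_le_finrank_add_finrank _ _)
  rw [finrank_Hom] at h4
  omega

/-- **`boxStd_j^k ⊔ boxSI_j^k = Hom(pre j, k)`.** -/
theorem boxStd_sup_boxSI : boxStd K m j k ⊔ boxSI K m j k = Hom K (Gen m) (pre m j) k :=
  le_antisymm (sup_le (boxStd_le_Hom K m hj k) (boxSI_le_Hom K m j k)) (boxSI_census K m hj k).2.1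

/-- **`boxStd_j^k ⊓ boxSI_j^k = 0`**: the box-standard span is a COMPLEMENT of the box Siegel ideal in `Hom(pre j, k)`. -/
theorem boxStd_inf_boxSI : boxStd K m j k ⊓ boxSI K m j k = ⊥ := by
  rw [← Submodule.finrank_eq_zero]
  have h := Submodule.finrank_sup_add_finrank_inf_eq (boxStd K m j k) (boxSI K m j k)
  rw [boxStd_sup_boxSI K m hj, finrank_Hom, finrank_boxStd K m hj, ← finrank_boxSI_add_cnt K m hj k] at h
  omega

end Prefix

/-- the box model has `|pre n| = Σ_i 2m_i` generators. -/
lemma card_pre_top : (pre m n).card = ∑ i : Fin n, (m i + m i) := by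
  rw [pre_top, Finset.card_univ, card_Gen]

/-- **THE DIMENSION OF THE BOX SIEGEL IDEAL: `dim boxSiegelIdeal_k + [t^k] Π_i G_{m_i}(t) = C(Σ_i 2m_i, k)`**, `G_m(t) = Σ_b (b+1)·C(m,b)·t^b` — every
field, every number of factors `n`, every dimensions `m_i`, every degree `k` (one factor: gen 11's `dim SI_k + (k+1)·C(m,k) = C(2m,k)`). -/
theorem finrank_boxSiegelIdeal (k : ℕ) :
    finrank K (boxSiegelIdeal K m k) + (∏ i : Fin n, stdPoly (m i)).coeff k = (∑ i : Fin n, (m i + m i)).choose k := by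
  rw [boxSiegelIdeal, ← cnt_top, ← card_pre_top, finrank_boxSI_add_cnt K m le_rfl]

/-- **`boxStd_n^k ⊕ boxSiegelIdeal_k = ⋀^k`**: the products of the factors' standard monomials span a complement of the box Siegel ideal. -/
theorem boxStd_sup_boxSiegelIdeal (k : ℕ) : boxStd K m n k ⊔ boxSiegelIdeal K m k = ⋀[K]^k (Gen m → K) := by
  rw [boxSiegelIdeal, boxStd_sup_boxSI K m le_rfl, pre_top, exteriorPower_eq_Hom_univ_gen]

/-- … with trivial intersection. -/
theorem boxStd_inf_boxSiegelIdeal (k : ℕ) : boxStd K m n k ⊓ boxSiegelIdeal K m k = ⊥ :=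
  boxStd_inf_boxSI K m le_rfl k

/-- **`dim boxStd_n^k = [t^k] Π_i G_{m_i}(t)`.** -/
theorem finrank_boxStd_top (k : ℕ) : finrank K (boxStd K m n k) = (∏ i : Fin n, stdPoly (m i)).coeff k := by
  rw [finrank_boxStd K m le_rfl, cnt_top]

/-- CHECK (two curve factors, degree 2): `[t²] (1+2t)² = 4`, so `dim boxSiegelIdeal_2 = C(4,2) − 4 = 2` — the two factors' Siegel lines `x₁y₁`, `x₂y₂`
(= `dim SiegelBox = Σ m_i(m_i+1)/2`, gen 10). -/
theorem coeff_stdPoly_one_sq : (stdPoly 1 * stdPoly 1).coeff 2 = 4 ∧ (1 + 1 + (1 + 1)).choose 2 = 6 := by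
  refine ⟨?_, by decide⟩
  rw [coeff_mul, Finset.Nat.sum_antidiagonal_eq_sum_range_succ (fun a b => (stdPoly 1).coeff a * (stdPoly 1).coeff b) 2]
  simp only [coeff_stdPoly]
  decide

/-! ## §8. The excess law for Hankel boxes -/

/-- **THE EXCESS LAW FOR HANKEL BOXES: `dim ker(θ ↦ θ ∧ F ∣ ⋀^k) + [t^k] Π_i H_{m_i}(q_i) = dim boxSiegelIdeal_k + [t^k] Π_i G_{m_i}`** (`n ≥ 1`; every
field, dimensions, classes, degree) — the `q`-dependent excess of the kernel over the `q`-independent box Siegel ideal is `[t^k](Π_i G_{m_i} −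
Π_i H_{m_i}(q_i))` (one factor: gen 11's `C(m,k)·(k+1 − rank H_k(q))`). -/
theorem finrank_ker_wedge_hankelBox_add (hn : 1 ≤ n) (q : Fin n → ℕ → K) (k : ℕ) :
    finrank K (LinearMap.ker (wedge K (Gen m) k (hankelBox K m q))) + (∏ i : Fin n, hankelPoly K (m i) (q i)).coeff k =
      finrank K (boxSiegelIdeal K m k) + (∏ i : Fin n, stdPoly (m i)).coeff k := by
  rw [finrank_boxSiegelIdeal, add_comm, finrank_range_add_finrank_ker_wedge_hankelBox K m hn q k]

/-- hence **`[t^k] Π_i H_{m_i}(q_i) ≤ [t^k] Π_i G_{m_i}`** for every classes (the box Siegel ideal lies in every kernel). -/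
theorem coeff_prod_hankelPoly_le (hn : 1 ≤ n) (q : Fin n → ℕ → K) (k : ℕ) :
    (∏ i : Fin n, hankelPoly K (m i) (q i)).coeff k ≤ (∏ i : Fin n, stdPoly (m i)).coeff k := by
  have h1 := finrank_ker_wedge_hankelBox_add K m hn q k
  have h2 := finrank_boxSiegelIdeal_le_finrank_ker K m k q
  omega

/-- **THE FULL-RANK CRITERION FOR BOXES: `ker(θ ↦ θ ∧ F ∣ ⋀^k) = boxSiegelIdeal_k ⟺ [t^k] Π_i H_{m_i}(q_i) = [t^k] Π_i G_{m_i}`** (`n ≥ 1`; the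
kernel read inside `⋀^k` along its inclusion). -/
theorem ker_wedge_hankelBox_eq_iff (hn : 1 ≤ n) (q : Fin n → ℕ → K) (k : ℕ) :
    LinearMap.ker (wedge K (Gen m) k (hankelBox K m q)) = (boxSiegelIdeal K m k).comap (⋀[K]^k (Gen m → K)).subtype ↔
      (∏ i : Fin n, hankelPoly K (m i) (q i)).coeff k = (∏ i : Fin n, stdPoly (m i)).coeff k := by
  have h1 := finrank_ker_wedge_hankelBox_add K m hn q k
  constructor
  · intro h
    rw [h, finrank_comap_boxSiegelIdeal] at h1
    omega
  · intro h
    symm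
    apply Submodule.eq_of_le_of_finrank_eq (boxSiegelIdeal_le_ker K m k q)
    rw [finrank_comap_boxSiegelIdeal]
    omega

end Summit.Ventures.HSemireg.Wedge.HankelBoxSiegelIdeal
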